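import Summits.QuantumFields.YangMills.Theorems.BalabanUVNodesN14ConvexFibreMatching
import Summits.QuantumFields.YangMills.Theorems.BalabanUVNodesN14ConvexFibrePerturb

/-!
# BalabanUVNodes ∕ node N14 = NE1′ — THE PRODUCER OF THE RESIDUAL AT SCHEMA LEVEL (boxes included, no Hessian letter): the two-run
# tilted mean matching across one fibre carrying RR-2's entropy schema UNIFORMLY in the background is second order in the fibre gradient

Cell `pub-ymgap`, HUMAN RULING D-0062 (Track A at full width), seat `pub-ymgap-dag-n14-c` (R134 ACCELERATION, strategy s1), generation 4;
route `Summits/QuantumFields/YangMills/Theses/BalabanUVNodes.lean` (cluster K3′ `SpineGivenEndpointR12`, `--supports … --as helper`); venue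
ruling R424 (`YangMills/Theorems`, namespace `YMDAG.N14.ConvexFibreMatchingBox`).  Eighth file of the convex-fibre engine; ADDITIVE — imports G
(`…ConvexFibreMatching`: the generic tilt lemmas and the whole-space convex producer) and F (`…ConvexFibrePerturb`: Holley–Stroock for the schema);
THEOREMS ONLY (0 `def`), modifies nothing.

WHY.  File G produces `TiltedMeanMatching` on the consistent tower for WHOLE-SPACE uniformly convex fibres with a Hessian letter `M` on the observable.
Bałaban's small-field fibres are BOX laws and the loop observable need not have a Hessian letter in the chart.  This file redoes G §2–§3 at SCHEMA
level: every fibre law `κ b` satisfies node00-def-RR-2's `HasEntropyExpC1c (κ b) C` (box fibres by `bobkovLedoux2000_prop31_convexDomain_exp`, PROVED),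
and the source `G` is merely measurable-bounded in the background and `C¹`-bounded-gradient along the fibre:
(a) the tilted fibre `(κ b).tilted (s·G(b,·))` keeps the schema with `C·e^{4l₀B₀}` (Holley–Stroock, F), so its variance is `≤ C e^{4l₀B₀} L²` (Herbst ⇒
sub-Gaussian ⇒ variance, E §3) and the tilted fibre mean moves by `≤ |s|·C e^{4l₀B₀} L²`; (b) the fibre born cumulant is `∈ [0, C L² s²∕2]` (D §1 + Jensen),
so the two background tilts cost `≤ B₀·(e^{C L² s²} − 1)`.

WHAT THIS IS.
* §1 **`abs_tiltedMean_compProd_sub_le_of_schema`** — `|tiltedMean G (ν ⊗ₘ κ) s − tiltedMean Ḡ ν s| ≤ |s|·C·e^{4l₀B₀}·L² + B₀·(e^{C·L²·s²} − 1)` on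
  `|s| ≤ l₀`, for ANY Markov fibre kernel with the schema uniformly in the background.
* §2 **`tiltedMeanMatching_of_consistentSchemaTower`** — the K-indexed binder over FINITE class pieces: `TiltedMeanMatching l₀ T Bad (fibre averages)
  ν G (ν ⊗ₘ κ) (fun K => l₀·C·e^{4l₀B₀}·(L K)² + B₀·(e^{C(L K)²l₀²} − 1))` — summable iff `Σ (L K)² < ∞`.
* §3 `tiltedMeanMatching_of_consistentBoxTower` — the same with every fibre a BOX law `(volume.restrict (Ω K b)).tilted (−V K (b,·))`, `V K (b,·)`
  `c`-convex ON its open convex box (any first-order field), `C = 1∕c` — by RR-2's Bobkov–Ledoux theorem fibre by fibre.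

WHAT THIS IS NOT.  Everything here is PROVED (0 `sorry`, 0 named facts).  The consistent-tower idealisation, the schema ∕ box convexity UNIFORMLY in
the history (NODE O's positivity statement) and the fibre-gradient decay `L K = L₀θ₁^K` are the hypotheses of any application; nothing of Bałaban's
instantiated; N14 NOT discharged; count-neutral.  One finite four-torus programme at fixed ε; NOT ℝ⁴, NOT OS, NOT a mass gap, NOT Clay.
-/

noncomputable section

namespace YMDAG.N14.ConvexFibreMatchingBox

open MeasureTheory ProbabilityTheory Set Filter Topology
open scoped RealInnerProductSpace ENNReal NNReal
open Literature.Analysis.FunctionSpaces (HasEntropyExpC1c bobkovLedoux2000_prop31_convexDomain_exp)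
open Summit.QuantumFields.BalabanUV.T4Continuum.NE1p.DressedMGFForm (tiltedMean TiltedMeanMatching)
open YMDAG.N14.ConvexFibreBox (bornCumulant_le_of_hasEntropyExpC1c isProbabilityMeasure_restrict_tilted)
open YMDAG.N14.ConvexFibreStep (measurable_fibreAvg abs_fibreAvg_le)
open YMDAG.N14.ConvexFibreTilt (compProd_tilted exists_tiltedKernel fibreMass_pos_measurable isProbabilityMeasure_tilted_fibreCumulant
  variance_le_of_hasSubgaussianMGF)
open YMDAG.N14.ConvexFibrePerturb (hasSubgaussianMGF_tilted_of_hasEntropyExpC1c)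
open YMDAG.N14.ConvexFibreMatching (abs_tiltedMean_sub_integral_le abs_integral_tilted_sub_tilted_le tiltedMean_smul_measure)

variable {n : ℕ}

/-! ## §1 The matching across one schema fibre, Hessian-free -/
section Step

variable {B : Type*} [MeasurableSpace B] {ν : Measure B} [IsProbabilityMeasure ν] {κ : Kernel B (EuclideanSpace ℝ (Fin n))}
  [IsMarkovKernel κ] {G : B × EuclideanSpace ℝ (Fin n) → ℝ} {C l₀ s B₀ L : ℝ}

/-- **THE TWO-RUN TILTED MEAN MATCHING ACROSS ONE SCHEMA FIBRE** [folklore ∘ files D∕E∕F∕G; cite: HolleyStroock1987; BakryGentilLedoux2014, Prop. 5.4.1;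
BobkovLedoux2000, Prop. 3.1 — all PROVED in the tree].  Background law `ν`; Markov fibre kernel `κ` with `HasEntropyExpC1c (κ b) C` for EVERY `b`
(`C > 0`); `G` measurable with `|G| ≤ B₀` (`B₀ ≥ 0`), every `G (b,·) ∈ C¹` with fibre gradient `≤ L` (`L > 0`); `|s| ≤ l₀`.  Then
`|tiltedMean G (ν ⊗ₘ κ) s − tiltedMean Ḡ ν s| ≤ |s|·(C·e^{4l₀B₀}·L²) + B₀·(e^{C·L²·s²} − 1)` — both terms O(L²). -/
theorem abs_tiltedMean_compProd_sub_le_of_schema (hκC : ∀ b, HasEntropyExpC1c (κ b) C) (hC : 0 < C) (hGm : Measurable G)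
    (hG : ∀ b, ContDiff ℝ 1 fun x => G (b, x)) (hGb : ∀ p, |G p| ≤ B₀) (hGD : ∀ b x, ‖fderiv ℝ (fun z => G (b, z)) x‖ ≤ L) (hL : 0 < L)
    (hs : |s| ≤ l₀) :
    |tiltedMean G (ν ⊗ₘ κ) s - tiltedMean (fun b => ∫ x, G (b, x) ∂(κ b)) ν s| ≤
      |s| * (C * Real.exp (4 * l₀ * B₀) * L ^ 2) + B₀ * (Real.exp (C * L ^ 2 * s ^ 2) - 1) := by
  have hl₀ : 0 ≤ l₀ := (abs_nonneg s).trans hs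
  -- the fibre average `Ḡ`
  set Gbar : B → ℝ := fun b => ∫ x, G (b, x) ∂(κ b) with hGbar
  have hGbarm : Measurable Gbar := measurable_fibreAvg hGm
  have hGbarb : ∀ b, |Gbar b| ≤ B₀ := abs_fibreAvg_le hGb
  -- the tilt `f = s·G`, a measurable version `η` of the tilted fibres, the fibre cumulant `Λ`
  have hfm : Measurable fun p : B × EuclideanSpace ℝ (Fin n) => s * G p := hGm.const_mul s
  have hfb : ∀ p : B × EuclideanSpace ℝ (Fin n), |s * G p| ≤ |s| * B₀ := fun p => by
    rw [abs_mul]; exact mul_le_mul_of_nonneg_left (hGb p) (abs_nonneg _)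
  obtain ⟨η, hηM, hη⟩ := exists_tiltedKernel (κ := κ) hfm hfb
  obtain ⟨hZlo, hZhi, hZm⟩ := fibreMass_pos_measurable (κ := κ) hfm hfb
  set Λ : B → ℝ := fun b => Real.log (∫ x, Real.exp (s * G (b, x)) ∂(κ b)) with hΛ
  have hZpos : ∀ b, 0 < ∫ x, Real.exp (s * G (b, x)) ∂(κ b) := fun b => (Real.exp_pos _).trans_le (hZlo b)
  have hΛm : Measurable Λ := Real.measurable_log.comp hZm
  have hΛb : ∀ b, |Λ b| ≤ |s| * B₀ := fun b => by
    rw [abs_le]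
    constructor
    · have := Real.log_le_log (Real.exp_pos _) (hZlo b)
      rwa [Real.log_exp] at this
    · have := Real.log_le_log (hZpos b) (hZhi b)
      rwa [Real.log_exp] at this
  haveI : IsProbabilityMeasure (ν.tilted Λ) := isProbabilityMeasure_tilted_fibreCumulant (ν := ν) (κ := κ) hGm hGb s
  -- T1 via `compProd_tilted`
  have hT1 : tiltedMean G (ν ⊗ₘ κ) s = ∫ b, (∫ x, G (b, x) ∂(η b)) ∂(ν.tilted Λ) := by
    rw [tiltedMean, compProd_tilted (ν := ν) (κ := κ) (η := η) hfm hfb hη]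
    exact Measure.integral_compProd ((integrable_const B₀).mono' hGm.aestronglyMeasurable (Eventually.of_forall fun p => by
      rw [Real.norm_eq_abs]; exact hGb p))
  have hinner : ∀ b, ∫ x, G (b, x) ∂(η b) = tiltedMean (fun x => G (b, x)) (κ b) s := fun b => by rw [hη b, tiltedMean]
  -- (a) the tilted fibre mean is within `|s|·C e^{4l₀B₀} L²` of the fibre mean (Holley–Stroock + Herbst + sub-Gaussian ⇒ variance)
  have ha : ∀ b, |tiltedMean (fun x => G (b, x)) (κ b) s - Gbar b| ≤ C * Real.exp (4 * l₀ * B₀) * L ^ 2 * |s| := fun b => by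
    have hGbm : Measurable fun x => G (b, x) := hGm.comp measurable_prodMk_left
    refine abs_tiltedMean_sub_integral_le (ν := κ b) hGbm (fun x => hGb (b, x)) fun τ hτ => ?_
    have hτ' : |τ| ≤ l₀ := hτ.trans hs
    have hUb' : ∀ x, |τ * G (b, x)| ≤ l₀ * B₀ := fun x => by
      rw [abs_mul]; exact mul_le_mul hτ' (hGb (b, x)) (abs_nonneg _) hl₀
    have hUm : Measurable fun x => τ * G (b, x) := hGbm.const_mul τ
    have hsg := hasSubgaussianMGF_tilted_of_hasEntropyExpC1c (ν := κ b) (U := fun x => τ * G (b, x)) (hκC b) hC hUm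
      (fun x => (abs_le.1 (hUb' x)).1) (fun x => (abs_le.1 (hUb' x)).2) (hG b) (fun x => hGb (b, x)) (hGD b) hL
    haveI : IsProbabilityMeasure ((κ b).tilted fun x => τ * G (b, x)) :=
      isProbabilityMeasure_tilted (Literature.Probability.Moments.integrable_exp_mul_of_abs_le_const _ hGbm (fun x => hGb (b, x)) τ)
    have hv := variance_le_of_hasSubgaussianMGF (μ := (κ b).tilted fun x => τ * G (b, x)) hGbm.aemeasurable hsg
    refine hv.trans (le_of_eq ?_)
    rw [show (2 : ℝ) * (l₀ * B₀ - -(l₀ * B₀)) = 4 * l₀ * B₀ by ring]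
    rfl
  -- (b) the background tilts `Λ` and `s·Ḡ` differ by the fibre's born cumulant `∈ [0, C L² s²/2]`
  have hδ : ∀ b, |Λ b - s * Gbar b| ≤ C * L ^ 2 * s ^ 2 / 2 := fun b => by
    have hcgf : Λ b = cgf (fun x => G (b, x)) (κ b) s := by rw [hΛ, cgf, mgf]
    have hup : cgf (fun x => G (b, x)) (κ b) s - s * Gbar b ≤ C * L ^ 2 * s ^ 2 / 2 :=
      bornCumulant_le_of_hasEntropyExpC1c (hκC b) hC (hG b) (fun x => hGb (b, x)) (hGD b) hL s
    have hlo : s * Gbar b ≤ cgf (fun x => G (b, x)) (κ b) s :=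
      Literature.MathematicalPhysics.QuantumFieldTheory.Balaban1983to89.T4DressingDefect.mul_integral_le_cgf
        (hGm.comp measurable_prodMk_left).aemeasurable (Eventually.of_forall fun x => hGb (b, x)) s
    rw [hcgf, abs_le]
    constructor
    · have : (0 : ℝ) ≤ C * L ^ 2 * s ^ 2 / 2 := by positivity
      linarith
    · linarith
  have hb : |∫ b, Gbar b ∂(ν.tilted Λ) - ∫ b, Gbar b ∂(ν.tilted fun b => s * Gbar b)| ≤ B₀ * (Real.exp (C * L ^ 2 * s ^ 2) - 1) := by
    have h := abs_integral_tilted_sub_tilted_le (ν := ν) hΛm (hGbarm.const_mul s) hΛb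
      (fun b => by rw [abs_mul]; exact mul_le_mul_of_nonneg_left (hGbarb b) (abs_nonneg s)) hGbarm hGbarb hδ
    have e : (2 : ℝ) * (C * L ^ 2 * s ^ 2 / 2) = C * L ^ 2 * s ^ 2 := by ring
    rwa [e] at h
  -- assemble
  have hT2 : tiltedMean Gbar ν s = ∫ b, Gbar b ∂(ν.tilted fun b => s * Gbar b) := rfl
  have hsplit : tiltedMean G (ν ⊗ₘ κ) s - tiltedMean Gbar ν s =
      (∫ b, (tiltedMean (fun x => G (b, x)) (κ b) s - Gbar b) ∂(ν.tilted Λ)) +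
        (∫ b, Gbar b ∂(ν.tilted Λ) - ∫ b, Gbar b ∂(ν.tilted fun b => s * Gbar b)) := by
    rw [hT1, hT2]
    have hi1 : Integrable (fun b => tiltedMean (fun x => G (b, x)) (κ b) s) (ν.tilted Λ) := by
      have hm : Measurable fun b => tiltedMean (fun x => G (b, x)) (κ b) s := by
        have : (fun b => tiltedMean (fun x => G (b, x)) (κ b) s) = fun b => ∫ x, G (b, x) ∂(η b) := funext fun b => (hinner b).symm
        rw [this]; exact measurable_fibreAvg (κ := η) hGm
      refine (integrable_const B₀).mono' hm.aestronglyMeasurable (Eventually.of_forall fun b => ?_)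
      rw [Real.norm_eq_abs]
      exact Summit.QuantumFields.BalabanUV.T4Continuum.NE1p.TiltedMeanInfluence.abs_tiltedMean_le (fun x => hGb (b, x))
        ((abs_nonneg _).trans (hGb (b, 0))) s
    have hi2 : Integrable Gbar (ν.tilted Λ) :=
      (integrable_const B₀).mono' hGbarm.aestronglyMeasurable (Eventually.of_forall fun b => by rw [Real.norm_eq_abs]; exact hGbarb b)
    rw [integral_sub hi1 hi2]
    simp only [hinner]
    ring
  rw [hsplit]
  refine (abs_add_le _ _).trans (add_le_add ?_ hb)
  rw [← Real.norm_eq_abs]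
  refine (norm_integral_le_of_norm_le_const (C := C * Real.exp (4 * l₀ * B₀) * L ^ 2 * |s|) (Eventually.of_forall fun b => ?_)).trans
    (le_of_eq ?_)
  · rw [Real.norm_eq_abs]; exact ha b
  · simp only [probReal_univ, mul_one]; ring

end Step

/-! ## §2 The binder on the consistent schema tower (finite class pieces) -/
section Tower

variable {ι : Type*} [DecidableEq ι] {Ω : ℕ → Type*} [∀ K, MeasurableSpace (Ω K)] {d : ℕ → ℕ}
  {T : ℕ → Finset ι} {Bad : ℕ → ℝ → Finset ι} {l₀ B₀ C : ℝ} {L : ℕ → ℝ}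
  {ν : ∀ K, ι → Measure (Ω K)} {κ : ∀ K, Kernel (Ω K) (EuclideanSpace ℝ (Fin (d K)))} {G : ∀ K, Ω K × EuclideanSpace ℝ (Fin (d K)) → ℝ}

/-- **`TiltedMeanMatching` ON THE CONSISTENT SCHEMA TOWER** [folklore ∘ §1].  For every depth `K`: run A = the finite class pieces `ν K τ` on `Ω K` with
observable the fibre average of `G K`; run B = `ν K τ ⊗ₘ κ K` with observable `G K`; EVERY fibre law `κ K b` satisfies `HasEntropyExpC1c (κ K b) C`
(`C > 0`; boxes included); `G K` measurable, `|G K| ≤ B₀`, fibrewise `C¹` with gradient size `L K > 0`; `l₀ ≥ 0`.  Then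
`TiltedMeanMatching l₀ T Bad (fibre averages) ν G (ν ⊗ₘ κ) (fun K => l₀·C·e^{4l₀B₀}·(L K)² + B₀·(e^{C(L K)²l₀²} − 1))`. -/
theorem tiltedMeanMatching_of_consistentSchemaTower (hC : 0 < C) (hB₀ : 0 ≤ B₀) (hl₀ : 0 ≤ l₀)
    (hν : ∀ K, ∀ τ ∈ T K, IsFiniteMeasure (ν K τ)) (hκM : ∀ K, IsMarkovKernel (κ K)) (hκC : ∀ K b, HasEntropyExpC1c (κ K b) C)
    (hGm : ∀ K, Measurable (G K)) (hG : ∀ K b, ContDiff ℝ 1 fun x => G K (b, x)) (hGb : ∀ K p, |G K p| ≤ B₀)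
    (hGD : ∀ K b x, ‖fderiv ℝ (fun z => G K (b, z)) x‖ ≤ L K) (hL : ∀ K, 0 < L K) :
    TiltedMeanMatching l₀ T Bad (fun K b => ∫ x, G K (b, x) ∂(κ K b)) ν G (fun K τ => ν K τ ⊗ₘ κ K)
      (fun K => l₀ * (C * Real.exp (4 * l₀ * B₀) * L K ^ 2) + B₀ * (Real.exp (C * L K ^ 2 * l₀ ^ 2) - 1)) := by
  intro K t _ τ hτ s hs
  have hτT : τ ∈ T K := (Finset.mem_sdiff.mp hτ).1
  haveI := hν K τ hτT
  haveI := hκM K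
  have hη0 : 0 ≤ l₀ * (C * Real.exp (4 * l₀ * B₀) * L K ^ 2) + B₀ * (Real.exp (C * L K ^ 2 * l₀ ^ 2) - 1) := by
    have : (1 : ℝ) ≤ Real.exp (C * L K ^ 2 * l₀ ^ 2) := Real.one_le_exp (by positivity)
    have h2 : 0 ≤ B₀ * (Real.exp (C * L K ^ 2 * l₀ ^ 2) - 1) := mul_nonneg hB₀ (by linarith)
    positivity
  by_cases h0 : ν K τ = 0
  · simp only [h0, Measure.compProd_zero_left, tiltedMean, tilted_zero_measure, integral_zero_measure, sub_zero, abs_zero]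
    exact hη0
  set c : ℝ≥0∞ := ν K τ Set.univ with hc
  have hc0 : c ≠ 0 := by rwa [hc, Ne, Measure.measure_univ_eq_zero]
  have hcT : c ≠ ∞ := measure_ne_top _ _
  have hci0 : c⁻¹ ≠ 0 := ENNReal.inv_ne_zero.2 hcT
  have hciT : c⁻¹ ≠ ∞ := ENNReal.inv_ne_top.2 hc0
  haveI : IsProbabilityMeasure (c⁻¹ • ν K τ) :=
    ⟨by rw [Measure.smul_apply, smul_eq_mul, hc, ENNReal.inv_mul_cancel hc0 hcT]⟩
  have e1 : tiltedMean (fun b => ∫ x, G K (b, x) ∂(κ K b)) (ν K τ) s = tiltedMean (fun b => ∫ x, G K (b, x) ∂(κ K b)) (c⁻¹ • ν K τ) s :=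
    (tiltedMean_smul_measure _ _ hci0 hciT s).symm
  have e2 : tiltedMean (G K) (ν K τ ⊗ₘ κ K) s = tiltedMean (G K) ((c⁻¹ • ν K τ) ⊗ₘ κ K) s := by
    rw [Measure.compProd_smul_left, tiltedMean_smul_measure _ _ hci0 hciT]
  rw [e1, e2]
  have hmain := abs_tiltedMean_compProd_sub_le_of_schema (ν := c⁻¹ • ν K τ) (κ := κ K) (hκC K) hC (hGm K) (hG K) (hGb K) (hGD K) (hL K) hs
  refine hmain.trans (add_le_add ?_ ?_)
  · exact mul_le_mul_of_nonneg_right hs (by positivity)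
  · refine mul_le_mul_of_nonneg_left ?_ hB₀
    have hss : s ^ 2 ≤ l₀ ^ 2 := by
      rw [← sq_abs s]; exact pow_le_pow_left₀ (abs_nonneg s) hs 2
    have : C * L K ^ 2 * s ^ 2 ≤ C * L K ^ 2 * l₀ ^ 2 := mul_le_mul_of_nonneg_left hss (by positivity)
    linarith [Real.exp_le_exp.2 this]

end Tower

/-! ## §3 The box tower: every fibre a box law, convex on its box uniformly in the history -/
section BoxTower

variable {ι : Type*} [DecidableEq ι] {Ω : ℕ → Type*} [∀ K, MeasurableSpace (Ω K)] {d : ℕ → ℕ}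
  {T : ℕ → Finset ι} {Bad : ℕ → ℝ → Finset ι} {l₀ B₀ c : ℝ} {L : ℕ → ℝ}
  {ν : ∀ K, ι → Measure (Ω K)} {κ : ∀ K, Kernel (Ω K) (EuclideanSpace ℝ (Fin (d K)))} {G V : ∀ K, Ω K × EuclideanSpace ℝ (Fin (d K)) → ℝ}
  {Bx : ∀ K, Ω K → Set (EuclideanSpace ℝ (Fin (d K)))} {W : ∀ K, Ω K → EuclideanSpace ℝ (Fin (d K)) → EuclideanSpace ℝ (Fin (d K))}

/-- **`TiltedMeanMatching` ON THE CONSISTENT BOX TOWER** [folklore ∘ §2; cite: BobkovLedoux2000, Prop. 3.1 — PROVED in the tree by node00-def-RR-2].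
As `tiltedMeanMatching_of_consistentSchemaTower`, with the schema SUPPLIED: every fibre law is the box law `(volume.restrict (Bx K b)).tilted (−V K (b,·))`
on an open convex box of nonzero volume, `V K (b,·)` continuous on the box and `c`-uniformly convex ON it in the first-order letter (any field
`W K b`), `e^{−V K (b,·)}` integrable on the box — uniformly in `K`, `b` (NODE O's positivity statement, here a HYPOTHESIS); `C = 1∕c`. -/
theorem tiltedMeanMatching_of_consistentBoxTower (hc : 0 < c) (hB₀ : 0 ≤ B₀) (hl₀ : 0 ≤ l₀)
    (hν : ∀ K, ∀ τ ∈ T K, IsFiniteMeasure (ν K τ)) (hκM : ∀ K, IsMarkovKernel (κ K))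
    (hκ : ∀ K b, κ K b = ((volume : Measure (EuclideanSpace ℝ (Fin (d K)))).restrict (Bx K b)).tilted fun x => -V K (b, x))
    (hBo : ∀ K b, IsOpen (Bx K b)) (hBc : ∀ K b, Convex ℝ (Bx K b)) (hVc : ∀ K b, ContinuousOn (fun x => V K (b, x)) (Bx K b))
    (hV : ∀ K b, ∀ x ∈ Bx K b, ∀ y ∈ Bx K b, V K (b, x) + ⟪W K b x, y - x⟫ + c / 2 * ‖y - x‖ ^ 2 ≤ V K (b, y))
    (hZ : ∀ K b, IntegrableOn (fun x => Real.exp (-V K (b, x))) (Bx K b))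
    (hGm : ∀ K, Measurable (G K)) (hG : ∀ K b, ContDiff ℝ 1 fun x => G K (b, x)) (hGb : ∀ K p, |G K p| ≤ B₀)
    (hGD : ∀ K b x, ‖fderiv ℝ (fun z => G K (b, z)) x‖ ≤ L K) (hL : ∀ K, 0 < L K) :
    TiltedMeanMatching l₀ T Bad (fun K b => ∫ x, G K (b, x) ∂(κ K b)) ν G (fun K τ => ν K τ ⊗ₘ κ K)
      (fun K => l₀ * (1 / c * Real.exp (4 * l₀ * B₀) * L K ^ 2) + B₀ * (Real.exp (1 / c * L K ^ 2 * l₀ ^ 2) - 1)) :=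
  tiltedMeanMatching_of_consistentSchemaTower (one_div_pos.2 hc) hB₀ hl₀ hν hκM
    (fun K b => by rw [hκ K b]; exact bobkovLedoux2000_prop31_convexDomain_exp (hBo K b) (hBc K b) hc (hVc K b) (hV K b) (hZ K b))
    hGm hG hGb hGD hL

end BoxTower

end YMDAG.N14.ConvexFibreMatchingBox

end
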